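import Mathlib.RingTheory.GradedAlgebra.HomogeneousLocalization
import Mathlib.RingTheory.Flat.EquationalCriterion
import Mathlib.RingTheory.RingHom.Flat
import Mathlib.Algebra.Module.Torsion.Basic
import HarnessLib

/-!
# `Proj` of a graded algebra with flat graded pieces is flat (Hartshorne III.9.9, (ii) ⇒ (i))

Let `A = ⊕_{n ≥ 0} 𝒜 n` be a graded `R`-algebra and `f ∈ 𝒜 d`, `d ≥ 1`. The affine piece
`D₊(f) = Spec A_{(f)}` of `Proj A` has coordinate ring the degree-`0` part
`A_{(f)} = HomogeneousLocalization.Away 𝒜 f` of `A_f`. We prove: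

* `flat_away_of_flat_pieces` — **if the graded pieces `𝒜 n` are flat `R`-modules for all
  `n ≥ k`, then `R → A_{(f)}` is flat.** This is the algebra in Hartshorne's proof of
  Thm. III.9.9, (ii) ⇒ (i) ("`M = ⊕_{m ≥ m₀} H⁰(X, 𝓕(m))` […] Since `M` is a free (and hence
  flat) `A`-module, we see that `𝓕 = M̃` is flat over `A`"): only the pieces of large degree
  matter, and `A_{(f)}` is the increasing union of the copies `a ↦ a / fᴺ` of `𝒜 (N d)`. We run
  Lazard's equational criterion (Mathlib `Module.Flat.iff_forall_isTrivialRelation`) through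
  that union: a relation `Σ rᵢ (aᵢ / fᴺ) = 0` gives `fᵐ Σ rᵢ aᵢ = 0` in `𝒜 ((m + N) d)`, which
  is trivial there by flatness, and the trivialisation divided by `f^{m+N}` trivialises the
  original relation.

* `flat_away_quotient_torsion_of_flat_pieces` — the same with `c^∞`-TORSION removed
  (`c ∈ R`): if the `c^∞`-torsion-free quotients of the pieces `𝒜 n`, `n ≥ k`, are flat, then so
  is the `c^∞`-torsion-free quotient of `A_{(f)}` — the coordinate ring of the chart `D₊(f)` of
  the STRICT TRANSFORM of `Proj A` along a blowing up whose exceptional divisor is `c = 0`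
  (Stacks 080D: strict transform = quotient by the sections supported on the exceptional
  divisor, i.e. by the `c^∞`-torsion). Same proof, run in the torsion-free quotients.

This is brick (4) of the Quot-free flattening road for de Jong 1996, 2.19 recorded in the cell
memo `lit/res-lit-4/gen21/FLATTENING-ROADMAP.md` §5.3 (flatness of the strict transform
`Proj C → Spec R'` from the flatness of the graded pieces `C_n`, `n ≥ k`).

## References

* [Hartshorne1977] R. Hartshorne, *Algebraic Geometry*, GTM 52 (1977), III, Thm. 9.9, proof of
  (ii) ⇒ (i), p. 262; Prop. 9.1 (1).
* [StacksProject] The Stacks Project, Tag 080D (strict transform along a blowing up).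
-/

noncomputable section

open HomogeneousLocalization

namespace Literature.RingTheory.GradedAlgebra

variable {R A : Type*} [CommRing R] [CommRing A] [Algebra R A]
  (𝒜 : ℕ → Submodule R A) [GradedAlgebra 𝒜] {f : A} {d : ℕ}

/-- `a ↦ a / f^N` on the graded piece `𝒜 (N • d)`, as an additive map to `A_{(f)}`. [folklore] -/
private def awayOfDeg (hf : f ∈ 𝒜 d) (N : ℕ) : 𝒜 (N • d) →+ HomogeneousLocalization.Away 𝒜 f where
  toFun a := Away.mk 𝒜 hf N a a.2
  map_zero' := by
    refine HomogeneousLocalization.val_injective _ ?_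
    simp only [Away.val_mk, Submodule.coe_zero, Localization.mk_zero, val_zero]
  map_add' a b := by
    refine HomogeneousLocalization.val_injective _ ?_
    simp only [Away.val_mk, val_add, Submodule.coe_add, Localization.add_mk_self]

/-- The value of `a / f^N` in `A_f`. [folklore] -/
private theorem val_awayOfDeg (hf : f ∈ 𝒜 d) (N : ℕ) (a : 𝒜 (N • d)) :
    (awayOfDeg 𝒜 hf N a).val = Localization.mk (a : A) (⟨f ^ N, ⟨N, rfl⟩⟩ : Submonoid.powers f) :=
  rfl

/-- Scalars: `(r / 1) · (a / f^N) = (r a) / f^N`. [folklore] -/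
private theorem algebraMap_mul_awayOfDeg (hf : f ∈ 𝒜 d) (N : ℕ) (r : R) (a : 𝒜 (N • d)) :
    ((fromZeroRingHom 𝒜 (Submonoid.powers f)).comp (algebraMap R (𝒜 0))) r *
      awayOfDeg 𝒜 hf N a = awayOfDeg 𝒜 hf N (r • a) := by
  refine HomogeneousLocalization.val_injective _ ?_
  rw [val_mul, val_awayOfDeg, val_awayOfDeg, RingHom.comp_apply]
  change (HomogeneousLocalization.mk _).val * _ = _
  rw [val_mk, Localization.mk_mul, Localization.mk_eq_mk_iff, Localization.r_iff_exists]
  exact ⟨1, by simp [Algebra.smul_def]⟩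

/-- Shifting the exponent: `(f^m a) / f^(m + N) = a / f^N`. [folklore] -/
private theorem awayOfDeg_shift (hf : f ∈ 𝒜 d) (N m : ℕ) (a : 𝒜 (N • d))
    (b : 𝒜 ((m + N) • d)) (hb : (b : A) = f ^ m * a) :
    awayOfDeg 𝒜 hf (m + N) b = awayOfDeg 𝒜 hf N a := by
  refine HomogeneousLocalization.val_injective _ ?_
  rw [val_awayOfDeg, val_awayOfDeg, Localization.mk_eq_mk_iff, Localization.r_iff_exists]
  exact ⟨1, by simp only [OneMemClass.coe_one, one_mul, hb]; ring⟩

/-- `a / f^N = 0` forces `f^m a = 0` for some `m`. [folklore] -/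
private theorem exists_pow_mul_eq_zero_of_awayOfDeg_eq_zero (hf : f ∈ 𝒜 d) (N : ℕ) (a : 𝒜 (N • d))
    (h : awayOfDeg 𝒜 hf N a = 0) : ∃ m : ℕ, f ^ m * (a : A) = 0 := by
  have hval : (awayOfDeg 𝒜 hf N a).val = 0 := by rw [h, val_zero]
  rw [val_awayOfDeg, Localization.mk_eq_mk'_apply, IsLocalization.mk'_eq_zero_iff] at hval
  obtain ⟨⟨c, m, rfl⟩, hc⟩ := hval
  exact ⟨m, hc⟩

/-- **Hartshorne III.9.9, (ii) ⇒ (i) (the algebra): if the graded pieces `𝒜 n`, `n ≥ k`, of a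
graded `R`-algebra `A` are flat over `R`, then the degree-`0` localisation `A_{(f)}`
(`f ∈ 𝒜 d`, `d ≥ 1`) — the coordinate ring of `D₊(f) ⊆ Proj A` — is flat over `R`.**
[cite: Hartshorne1977, III Thm. 9.9, proof of (ii) ⇒ (i), p. 262] -/
theorem flat_away_of_flat_pieces (hf : f ∈ 𝒜 d) (hd : 0 < d) {k : ℕ}
    (hflat : ∀ n, k ≤ n → Module.Flat R (𝒜 n)) :
    ((fromZeroRingHom 𝒜 (Submonoid.powers f)).comp (algebraMap R (𝒜 0))).Flat := by
  letI : Algebra R (HomogeneousLocalization.Away 𝒜 f) :=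
    ((fromZeroRingHom 𝒜 (Submonoid.powers f)).comp (algebraMap R (𝒜 0))).toAlgebra
  have key : ∀ (N : ℕ) (r : R) (a : 𝒜 (N • d)),
      algebraMap R (HomogeneousLocalization.Away 𝒜 f) r * awayOfDeg 𝒜 hf N a =
        awayOfDeg 𝒜 hf N (r • a) :=
    fun N r a => algebraMap_mul_awayOfDeg 𝒜 hf N r a
  show Module.Flat R (HomogeneousLocalization.Away 𝒜 f)
  rw [Module.Flat.iff_forall_isTrivialRelation]
  intro l r x hx
  -- write `x i = a i / f^(n i)`
  choose n a ha hxa using fun i => Away.mk_surjective 𝒜 hf (x i)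
  -- a common exponent `N ≥ k`
  obtain ⟨N, hkN, hnN⟩ : ∃ N, k ≤ N ∧ ∀ i, n i ≤ N :=
    ⟨k + ∑ i, n i, Nat.le_add_right _ _, fun i =>
      (Finset.single_le_sum (fun j _ => Nat.zero_le (n j)) (Finset.mem_univ i)).trans
        (Nat.le_add_left _ _)⟩
  have hb : ∀ i, f ^ (N - n i) * a i ∈ 𝒜 (N • d) := fun i => by
    have := SetLike.mul_mem_graded (SetLike.pow_mem_graded (N - n i) hf) (ha i)
    rwa [← add_nsmul, Nat.sub_add_cancel (hnN i)] at this
  let b : Fin l → 𝒜 (N • d) := fun i => ⟨_, hb i⟩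
  have hxb : ∀ i, x i = awayOfDeg 𝒜 hf N (b i) := by
    intro i
    have hb' : f ^ (N - n i) * a i ∈ 𝒜 ((N - n i + n i) • d) := by
      rw [Nat.sub_add_cancel (hnN i)]; exact hb i
    rw [← hxa i]
    have h1 : awayOfDeg 𝒜 hf (N - n i + n i) ⟨_, hb'⟩ = awayOfDeg 𝒜 hf (n i) ⟨a i, ha i⟩ :=
      awayOfDeg_shift 𝒜 hf (n i) (N - n i) ⟨a i, ha i⟩ ⟨_, hb'⟩ rfl
    have h2 : awayOfDeg 𝒜 hf (N - n i + n i) ⟨_, hb'⟩ = awayOfDeg 𝒜 hf N (b i) := by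
      refine HomogeneousLocalization.val_injective _ ?_
      rw [val_awayOfDeg, val_awayOfDeg, Localization.mk_eq_mk_iff, Localization.r_iff_exists]
      exact ⟨1, by simp [b, Nat.sub_add_cancel (hnN i)]⟩
    rw [← h2, h1]
    rfl
  -- the relation says `(Σ r i • b i) / f^N = 0`, so `f^m Σ r i • b i = 0` for some `m`
  have hrel : awayOfDeg 𝒜 hf N (∑ i, r i • b i) = 0 := by
    rw [map_sum, ← hx]
    exact Finset.sum_congr rfl fun i _ => by
      rw [hxb i, Algebra.smul_def (r i) (awayOfDeg 𝒜 hf N (b i)), key]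
  obtain ⟨m, hm⟩ := exists_pow_mul_eq_zero_of_awayOfDeg_eq_zero 𝒜 hf N _ hrel
  -- the relation `Σ r i • (f^m b i) = 0` in the flat module `𝒜 ((m + N) • d)`
  have hc : ∀ i, f ^ m * (b i : A) ∈ 𝒜 ((m + N) • d) := fun i => by
    have := SetLike.mul_mem_graded (SetLike.pow_mem_graded m hf) (b i).2
    rwa [← add_nsmul] at this
  let c : Fin l → 𝒜 ((m + N) • d) := fun i => ⟨_, hc i⟩
  have hsum : ∑ i, r i • c i = 0 := by
    apply Subtype.ext
    rw [Submodule.coe_sum, Submodule.coe_zero, ← hm, Submodule.coe_sum, Finset.mul_sum]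
    refine Finset.sum_congr rfl fun i _ => ?_
    simp only [c, Submodule.coe_smul, mul_smul_comm]
  haveI : Module.Flat R (𝒜 ((m + N) • d)) := hflat _ (by
    rw [smul_eq_mul]
    calc k ≤ N := hkN
      _ ≤ (m + N) * d := by nlinarith)
  obtain ⟨κ, coef, y, hy, hcoef⟩ := Module.Flat.isTrivialRelation_of_sum_smul_eq_zero hsum
  refine ⟨κ, coef, fun j => awayOfDeg 𝒜 hf (m + N) (y j), fun i => ?_, hcoef⟩
  rw [hxb i, ← awayOfDeg_shift 𝒜 hf N m (b i) (c i) rfl, hy i, map_sum]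
  refine Finset.sum_congr rfl fun j _ => ?_
  dsimp only
  rw [Algebra.smul_def (coef i j) (awayOfDeg 𝒜 hf (m + N) (y j)), key]

/-! ## The same modulo `c^∞`-torsion (strict transforms) -/

/-- Membership in the `c^∞`-torsion submodule `⨆ₘ M[cᵐ]`. [folklore] -/
private theorem mem_iSup_torsionBy_pow_iff {M : Type*} [AddCommGroup M] [Module R M] (c : R)
    (x : M) : x ∈ (⨆ m : ℕ, Submodule.torsionBy R M (c ^ m)) ↔ ∃ m : ℕ, c ^ m • x = 0 := by
  have hdir : Directed (· ≤ ·) fun m : ℕ => Submodule.torsionBy R M (c ^ m) := by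
    refine Monotone.directed_le fun m n hmn => ?_
    intro y hy
    rw [Submodule.mem_torsionBy_iff] at hy ⊢
    rw [← Nat.add_sub_cancel' hmn, pow_add, mul_comm, mul_smul, hy, smul_zero]
  rw [Submodule.mem_iSup_of_directed _ hdir]
  simp only [Submodule.mem_torsionBy_iff]

/-- **Hartshorne III.9.9 (ii) ⇒ (i) for strict transforms.** Let `A = ⊕ 𝒜 n` be a graded
`R`-algebra, `c ∈ R`, `f ∈ 𝒜 d`, `d ≥ 1`, and give `A_{(f)}` its `R`-algebra structure through
`𝒜 0`. If the `c^∞`-torsion-free quotients `𝒜 n / 𝒜 n[c^∞]` are flat over `R` for all `n ≥ k`,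
then `A_{(f)} / A_{(f)}[c^∞]` is flat over `R`. (With `A = R ⊗ B` the base change of a
homogeneous coordinate ring along a chart `R` of a blowing up with exceptional equation `c`, this
is the flatness of the chart `D₊(f)` of the strict transform, Stacks 080D, from the flatness of the
strict transforms of the graded pieces.)
[cite: Hartshorne1977, III Thm. 9.9, proof of (ii) ⇒ (i), p. 262] [cite: StacksProject, Tag 080D] -/
theorem flat_away_quotient_torsion_of_flat_pieces [Algebra R (HomogeneousLocalization.Away 𝒜 f)]
    (hφ : algebraMap R (HomogeneousLocalization.Away 𝒜 f) =
      (fromZeroRingHom 𝒜 (Submonoid.powers f)).comp (algebraMap R (𝒜 0)))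
    (hf : f ∈ 𝒜 d) (hd : 0 < d) (c : R) {k : ℕ}
    (hflat : ∀ n, k ≤ n →
      Module.Flat R (𝒜 n ⧸ ⨆ m : ℕ, Submodule.torsionBy R (𝒜 n) (c ^ m))) :
    Module.Flat R (HomogeneousLocalization.Away 𝒜 f ⧸
      ⨆ m : ℕ, Submodule.torsionBy R (HomogeneousLocalization.Away 𝒜 f) (c ^ m)) := by
  have key : ∀ (N : ℕ) (r : R) (a : 𝒜 (N • d)),
      algebraMap R (HomogeneousLocalization.Away 𝒜 f) r * awayOfDeg 𝒜 hf N a =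
        awayOfDeg 𝒜 hf N (r • a) := fun N r a => by
    rw [hφ]; exact algebraMap_mul_awayOfDeg 𝒜 hf N r a
  set T := ⨆ m : ℕ, Submodule.torsionBy R (HomogeneousLocalization.Away 𝒜 f) (c ^ m) with hT
  -- `F M := (a ↦ class of a / f^M)`, additive and `R`-linear, killing `c^∞`-torsion
  let F : ∀ M : ℕ, 𝒜 (M • d) →+ HomogeneousLocalization.Away 𝒜 f ⧸ T :=
    fun M => T.mkQ.toAddMonoidHom.comp (awayOfDeg 𝒜 hf M)
  have hF : ∀ (M : ℕ) (v : 𝒜 (M • d)), F M v = T.mkQ (awayOfDeg 𝒜 hf M v) := fun M v => rfl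
  have hF_smul : ∀ (M : ℕ) (s : R) (v : 𝒜 (M • d)), F M (s • v) = s • F M v := by
    intro M s v
    rw [hF, hF, ← key, ← Algebra.smul_def s (awayOfDeg 𝒜 hf M v), LinearMap.map_smul]
  have hF_tors : ∀ (M : ℕ) (v : 𝒜 (M • d)) (m : ℕ), c ^ m • v = 0 → F M v = 0 := by
    intro M v m hv
    rw [hF, Submodule.mkQ_apply, Submodule.Quotient.mk_eq_zero, hT, mem_iSup_torsionBy_pow_iff]
    exact ⟨m, by rw [Algebra.smul_def (c ^ m) (awayOfDeg 𝒜 hf M v), key, hv, map_zero]⟩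
  rw [Module.Flat.iff_forall_isTrivialRelation]
  intro l r x hx
  -- lift `x i` to `A_{(f)}` and write it as `a i / f^(n i)`
  have hz : ∀ i, ∃ z, T.mkQ z = x i := fun i => Submodule.mkQ_surjective _ (x i)
  choose z hzx using hz
  choose n a ha hxa using fun i => Away.mk_surjective 𝒜 hf (z i)
  obtain ⟨N, hkN, hnN⟩ : ∃ N, k ≤ N ∧ ∀ i, n i ≤ N :=
    ⟨k + ∑ i, n i, Nat.le_add_right _ _, fun i =>
      (Finset.single_le_sum (fun j _ => Nat.zero_le (n j)) (Finset.mem_univ i)).trans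
        (Nat.le_add_left _ _)⟩
  have hb : ∀ i, f ^ (N - n i) * a i ∈ 𝒜 (N • d) := fun i => by
    have := SetLike.mul_mem_graded (SetLike.pow_mem_graded (N - n i) hf) (ha i)
    rwa [← add_nsmul, Nat.sub_add_cancel (hnN i)] at this
  let b : Fin l → 𝒜 (N • d) := fun i => ⟨_, hb i⟩
  have hzb : ∀ i, z i = awayOfDeg 𝒜 hf N (b i) := by
    intro i
    have hb' : f ^ (N - n i) * a i ∈ 𝒜 ((N - n i + n i) • d) := by
      rw [Nat.sub_add_cancel (hnN i)]; exact hb i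
    rw [← hxa i]
    have h1 : awayOfDeg 𝒜 hf (N - n i + n i) ⟨_, hb'⟩ = awayOfDeg 𝒜 hf (n i) ⟨a i, ha i⟩ :=
      awayOfDeg_shift 𝒜 hf (n i) (N - n i) ⟨a i, ha i⟩ ⟨_, hb'⟩ rfl
    have h2 : awayOfDeg 𝒜 hf (N - n i + n i) ⟨_, hb'⟩ = awayOfDeg 𝒜 hf N (b i) := by
      refine HomogeneousLocalization.val_injective _ ?_
      rw [val_awayOfDeg, val_awayOfDeg, Localization.mk_eq_mk_iff, Localization.r_iff_exists]
      exact ⟨1, by simp [b, Nat.sub_add_cancel (hnN i)]⟩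
    rw [← h2, h1]
    rfl
  have hxF : ∀ i, x i = F N (b i) := fun i => by rw [hF, ← hzb, hzx]
  -- the relation: `F N (Σ r i • b i) = 0`, so `(Σ r i • b i) / f^N` is `c^m`-torsion
  have hrel : T.mkQ (awayOfDeg 𝒜 hf N (∑ i, r i • b i)) = 0 := by
    rw [← hF, map_sum, ← hx]
    exact Finset.sum_congr rfl fun i _ => by rw [hF_smul, hxF]
  rw [Submodule.mkQ_apply, Submodule.Quotient.mk_eq_zero, hT, mem_iSup_torsionBy_pow_iff] at hrel
  obtain ⟨m, hm⟩ := hrel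
  rw [Algebra.smul_def (c ^ m) (awayOfDeg 𝒜 hf N _), key] at hm
  obtain ⟨j, hj⟩ := exists_pow_mul_eq_zero_of_awayOfDeg_eq_zero 𝒜 hf N _ hm
  -- move to degree `(j + N) • d`: `cc i = f^j b i`
  have hc : ∀ i, f ^ j * (b i : A) ∈ 𝒜 ((j + N) • d) := fun i => by
    have := SetLike.mul_mem_graded (SetLike.pow_mem_graded j hf) (b i).2
    rwa [← add_nsmul] at this
  let cc : Fin l → 𝒜 ((j + N) • d) := fun i => ⟨_, hc i⟩
  -- in the flat quotient `Q = 𝒜 ((j+N) d) / torsion` the relation `Σ r i • [cc i] = 0` holds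
  set Tn := ⨆ m' : ℕ, Submodule.torsionBy R (𝒜 ((j + N) • d)) (c ^ m') with hTn
  have htors : (∑ i, r i • cc i) ∈ Tn := by
    rw [hTn, mem_iSup_torsionBy_pow_iff]
    refine ⟨m, Subtype.ext ?_⟩
    have h1 : ((c ^ m • ∑ i, r i • cc i : 𝒜 ((j + N) • d)) : A) =
        f ^ j * ((c ^ m • ∑ i, r i • b i : 𝒜 (N • d)) : A) := by
      simp only [Submodule.coe_smul, Submodule.coe_sum, cc, Finset.smul_sum, Finset.mul_sum,
        mul_smul_comm]
    rw [h1, hj, Submodule.coe_zero]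
  have hsumQ : ∑ i, r i • Tn.mkQ (cc i) = 0 := by
    rw [show ∑ i, r i • Tn.mkQ (cc i) = Tn.mkQ (∑ i, r i • cc i) by
      rw [map_sum]; simp only [map_smul]]
    rw [Submodule.mkQ_apply, Submodule.Quotient.mk_eq_zero]
    exact htors
  haveI : Module.Flat R (𝒜 ((j + N) • d) ⧸ Tn) := hflat _ (by
    rw [smul_eq_mul]
    calc k ≤ N := hkN
      _ ≤ (j + N) * d := by nlinarith)
  obtain ⟨κ, coef, w, hw, hcoef⟩ := Module.Flat.isTrivialRelation_of_sum_smul_eq_zero hsumQ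
  choose y hy using fun t => Submodule.mkQ_surjective Tn (w t)
  refine ⟨κ, coef, fun t => F (j + N) (y t), fun i => ?_, hcoef⟩
  -- `cc i - Σ coef i t • y t` is `c^∞`-torsion, hence killed by `F`
  have hwi : Tn.mkQ (cc i) = ∑ t, coef i t • w t := hw i
  have hdiff : (cc i - ∑ t, coef i t • y t) ∈ Tn := by
    rw [← Submodule.Quotient.eq, ← Submodule.mkQ_apply, ← Submodule.mkQ_apply, hwi, map_sum]
    exact Finset.sum_congr rfl fun t _ => by rw [map_smul, hy]
  rw [hTn, mem_iSup_torsionBy_pow_iff] at hdiff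
  obtain ⟨m', hm'⟩ := hdiff
  have hzero : F (j + N) (cc i - ∑ t, coef i t • y t) = 0 := hF_tors _ _ m' hm'
  rw [map_sub, map_sum, sub_eq_zero] at hzero
  calc x i = F N (b i) := hxF i
    _ = F (j + N) (cc i) := by
        rw [hF, hF, ← awayOfDeg_shift 𝒜 hf N j (b i) (cc i) rfl]
    _ = ∑ t, F (j + N) (coef i t • y t) := hzero
    _ = ∑ t, coef i t • F (j + N) (y t) := Finset.sum_congr rfl fun t _ => hF_smul _ _ _

end Literature.RingTheory.GradedAlgebra

end
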